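import Literature.Barriers.ValiantsHypothesis.TauRealZeros
import HarnessLib

/-!
# Barrier catalogue `ValiantsHypothesis`: real-zero counting fails for EVERY squaring-cheap
measure (typed form of `TauRealZeros`)

D-0021 barrier entry, the typed generalisation of `TauRealZeros.lean` asked for by the
barrier-inversion lens of route `ValiantsHypothesis/LacunarySymmetroid`: the Chebyshev obstruction
to proving the τ-conjecture by counting REAL zeros uses of `τ` only two properties —
`τ(X) = O(1)` and `τ(2p² - 1) ≤ τ(p) + O(1)` (one Chebyshev doubling step `T₂(y) = 2y² - 1` at
additive cost). Every measure `μ : ℤ[X] → ℕ` with these two properties ("squaring-cheap with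
constant `a`", `IsSquaringCheap μ a`) has `μ(T_{2^k}) ≤ a(k + 1)` while `T_{2^k}` has `2^k` distinct
real zeros, so no subexponential bound on the number of distinct real zeros in terms of `μ` can
hold.

**The printed obstruction** (as in `TauRealZeros.lean`, re-read on the page). Koiran, ICS 2011
(arXiv:1004.4960v4), §1, p. 3: "a bound on the number of real roots of a polynomial is a fortiori
a bound on its number of integer roots). It is known that this approach cannot work for the
original τ-conjecture because the number of real roots of a univariate polynomial can grow
exponentially as a function of its arithmetic circuit size: Chebyshev polynomials provide such an
example". Bürgisser, *Completeness classes in algebraic complexity theory* (2024), §4.6 (p. 20 of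
the arXiv version): "The τ-conjecture is false when replacing "integer zeros" by "real zeros"."

**What this file proves** (everything; no named fact besides the barrier `Prop`, itself proved):
* `IsSquaringCheap μ a` — the technique-class parameter: `μ X ≤ a` and
  `μ (2p² - 1) ≤ μ p + a` for all `p ∈ ℤ[X]`;
* `T_two_pow_succ` — `T_{2^{k+1}} = 2 T_{2^k}² - 1` in `ℤ[X]`;
* `IsSquaringCheap.apply_T_two_pow_le` — `μ(T_{2^k}) ≤ a(k + 1)`;
* `IsSquaringCheap.two_pow_le_of_realZeroBound` — a monotone bound `z_ℝ(f) ≤ F(μ f)` on the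
  distinct real zeros of all nonzero `f` forces `2^k ≤ F(a(k + 1))` for every `k`; hence
  `IsSquaringCheap.not_realZeroBound_of_lt_two_pow` (any single `k` with `F(a(k+1)) < 2^k` refutes
  `F`) and `IsSquaringCheap.not_realZeroBound_pow` (no polynomial shape `(μ f + 2)^c`);
* `isSquaringCheap_tau` — the tree's `τ` (`CplxAlg.constantFreeComplexity` of the image in
  `MvPolynomial (Fin 1) ℤ`, as in `RealZeroTauBound`) is squaring-cheap with `a = 3`, so
  `TauRealZeros` (`tauRealZeros_holds`, not restated) is the instance `μ = τ`
  (`two_pow_le_of_realZeroBound_tauMeasure`);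
* the barrier `TauRealZerosSquaringTyped`, PROVED (`tauRealZerosSquaringTyped_holds`).

**Addenda (same day, all proved).**
* `IsSquaringCheap.of_mvPolynomial` — a measure given on `MvPolynomial (Fin 1) ℤ` (as
  `CplxAlg.constantFreeComplexity` is) with the two closure properties there induces a
  squaring-cheap measure on `ℤ[X]` through `MvPolynomial.uniqueAlgEquiv`;
* `IsSquaringCheap.two_pow_le_of_realZeroBound_of_le` — the wall is inherited by every measure
  DOMINATED by a squaring-cheap one; instance `two_pow_le_of_realZeroBound_complexity`: Bürgisser's
  total complexity with free integer constants (`CplxAlg.complexity`, `L ≤ τ` by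
  `complexity_le_constantFreeComplexity_holds`) — "as a function of its arithmetic circuit size";
* `IsSquaringCheap.not_realZeroBound_quasipoly` — also the quasi-polynomial shape
  `2^{(log₂(μ f + 2))^c}` is excluded for every squaring-cheap `μ` (typed form of
  `not_realZeroBound_quasipoly` of `TauRealZeros.lean`; for SPS polynomials a bound
  `q(s) ≤ 2^{(log s)^{1+c}}` "would still be strong enough to conclude that the permanent is not in
  VP⁰", Koiran 2011, §6, p. 11 of the arXiv version).

## References

* [Koiran2011] P. Koiran, *Shallow circuits with high-powered inputs*, ICS 2011
  (arXiv:1004.4960v4), §1 (p. 3).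
* [Burgisser2024Completeness] P. Bürgisser, *Completeness classes in algebraic complexity theory*
  (arXiv:2406.06217), §4.6 (p. 20).
-/

noncomputable section

namespace Literature.Barriers.ValiantsHypothesis

open Polynomial Polynomial.Chebyshev MvPolynomial Literature.Computability.AlgebraicComplexity
  Literature.Computability.AlgebraicComplexity.ArithCircuit

/-! ### The technique-class parameter: squaring-cheap measures -/

/-- A measure `μ : ℤ[X] → ℕ` is **squaring-cheap with constant `a`** if the variable costs at most
`a` and one Chebyshev doubling step `p ↦ T₂(p) = 2p² - 1` costs at most `a` more than `p`:
`μ X ≤ a` and `μ (2p² - 1) ≤ μ p + a`. These are the only two properties of `τ` used by the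
Chebyshev counterexample ("the number of real roots of a univariate polynomial can grow
exponentially as a function of its arithmetic circuit size: Chebyshev polynomials provide such an
example"). [cite: Koiran2011, §1 (p. 3)] -/
def IsSquaringCheap (μ : Polynomial ℤ → ℕ) (a : ℕ) : Prop :=
  μ Polynomial.X ≤ a ∧ ∀ p : Polynomial ℤ, μ (2 * p ^ 2 - 1) ≤ μ p + a

/-- Squaring-cheapness is monotone in the constant. [folklore] -/
theorem IsSquaringCheap.mono {μ : Polynomial ℤ → ℕ} {a a' : ℕ} (h : IsSquaringCheap μ a)
    (ha : a ≤ a') : IsSquaringCheap μ a' :=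
  ⟨h.1.trans ha, fun p => (h.2 p).trans (by omega)⟩

/-- The Chebyshev doubling recurrence in `ℤ[X]`: `T_{2^{k+1}} = 2 T_{2^k}² - 1`
(`T_{2m} = T₂ ∘ T_m`, `T₂ = 2X² - 1`). [folklore] -/
theorem T_two_pow_succ (k : ℕ) :
    T ℤ ((2 ^ (k + 1) : ℕ) : ℤ) = 2 * T ℤ ((2 ^ k : ℕ) : ℤ) ^ 2 - 1 := by
  have h : T ℤ ((2 ^ (k + 1) : ℕ) : ℤ) = (T ℤ 2).comp (T ℤ ((2 ^ k : ℕ) : ℤ)) := by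
    rw [← T_mul]; congr 1; push_cast; ring
  rw [h, T_two]
  simp only [sub_comp, mul_comp, pow_comp, X_comp, one_comp, Polynomial.ofNat_comp]
  norm_num

/-- `T_{2^0} = T_1 = X`. [folklore] -/
theorem T_two_pow_zero : T ℤ ((2 ^ 0 : ℕ) : ℤ) = Polynomial.X := by
  simp

/-- **`μ(T_{2^k}) ≤ a(k + 1)` for every squaring-cheap `μ`**: `k` doubling steps from `X`.
[cite: Koiran2011, §1 (p. 3)] -/
theorem IsSquaringCheap.apply_T_two_pow_le {μ : Polynomial ℤ → ℕ} {a : ℕ}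
    (h : IsSquaringCheap μ a) (k : ℕ) : μ (T ℤ ((2 ^ k : ℕ) : ℤ)) ≤ a * (k + 1) := by
  induction k with
  | zero => simpa [T_two_pow_zero] using h.1
  | succ k ih =>
    rw [T_two_pow_succ]
    calc μ (2 * T ℤ ((2 ^ k : ℕ) : ℤ) ^ 2 - 1) ≤ μ (T ℤ ((2 ^ k : ℕ) : ℤ)) + a := h.2 _
      _ ≤ a * (k + 1) + a := by omega
      _ = a * (k + 1 + 1) := by ring

/-- **The witness for a squaring-cheap measure**: for every `k`, `f = T_{2^k}` is nonzero, has
`μ f ≤ a(k + 1)` and exactly `2^k` distinct real zeros. [cite: Koiran2011, §1 (p. 3)] -/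
theorem IsSquaringCheap.exists_apply_le_realRoots_eq_two_pow {μ : Polynomial ℤ → ℕ} {a : ℕ}
    (h : IsSquaringCheap μ a) (k : ℕ) :
    ∃ f : Polynomial ℤ, f ≠ 0 ∧ μ f ≤ a * (k + 1) ∧
      (f.map (Int.castRingHom ℝ)).roots.toFinset.card = 2 ^ k :=
  ⟨T ℤ ((2 ^ k : ℕ) : ℤ), chebyshev_T_two_pow_ne_zero k, h.apply_T_two_pow_le k,
    card_realRoots_chebyshevT k⟩

/-! ### The wall for squaring-cheap measures -/

/-- **Any real-zero bound in terms of a squaring-cheap measure is at least exponential**: if a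
monotone `F` bounds the number of distinct real zeros of every nonzero `f ∈ ℤ[X]` by `F(μ f)`,
then `2^k ≤ F(a(k + 1))` for all `k`. (Monotonicity is no restriction: the running maximum of a
valid bound is a valid monotone bound.) [cite: Koiran2011, §1 (p. 3)] -/
theorem IsSquaringCheap.two_pow_le_of_realZeroBound {μ : Polynomial ℤ → ℕ} {a : ℕ}
    (h : IsSquaringCheap μ a) {F : ℕ → ℕ} (hF : Monotone F)
    (hb : ∀ f : Polynomial ℤ, f ≠ 0 → (f.map (Int.castRingHom ℝ)).roots.toFinset.card ≤ F (μ f))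
    (k : ℕ) : 2 ^ k ≤ F (a * (k + 1)) := by
  obtain ⟨f, hf, hμ, hz⟩ := h.exists_apply_le_realRoots_eq_two_pow k
  exact hz ▸ (hb f hf).trans (hF hμ)

/-- **Growth-rate-agnostic wall**: a monotone `F` with `F(a(k + 1)) < 2^k` for a single `k` is not
a bound on the distinct real zeros in terms of any `μ` squaring-cheap with constant `a`.
[cite: Koiran2011, §1 (p. 3)] -/
theorem IsSquaringCheap.not_realZeroBound_of_lt_two_pow {μ : Polynomial ℤ → ℕ} {a : ℕ}
    (h : IsSquaringCheap μ a) {F : ℕ → ℕ} (hF : Monotone F) {k : ℕ} (hk : F (a * (k + 1)) < 2 ^ k) :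
    ¬ ∀ f : Polynomial ℤ, f ≠ 0 → (f.map (Int.castRingHom ℝ)).roots.toFinset.card ≤ F (μ f) :=
  fun hb => (h.two_pow_le_of_realZeroBound hF hb k).not_gt hk

/-- **No polynomial shape**: for no `c` is `(μ f + 2)^c` a bound on the distinct real zeros of
every nonzero `f ∈ ℤ[X]` when `μ` is squaring-cheap — the typed form of `TauRealZeros`
("The τ-conjecture is false when replacing "integer zeros" by "real zeros"" for `μ = τ`).
[cite: Burgisser2024Completeness, §4.6] [cite: Koiran2011, §1 (p. 3)] -/
theorem IsSquaringCheap.not_realZeroBound_pow {μ : Polynomial ℤ → ℕ} {a : ℕ}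
    (h : IsSquaringCheap μ a) (c : ℕ) :
    ¬ ∀ f : Polynomial ℤ, f ≠ 0 →
      (f.map (Int.castRingHom ℝ)).roots.toFinset.card ≤ (μ f + 2) ^ c := by
  have hmono : Monotone fun t : ℕ => (t + 2) ^ c := fun s t hst =>
    Nat.pow_le_pow_left (by omega) c
  obtain ⟨T₀, hT⟩ := eventually_mul_pow_lt_two_pow c (2 * (a + 2) ^ c)
  -- take `k + 1 = t ≥ max T₀ 1`
  set t : ℕ := max T₀ 1 with ht
  have ht1 : 1 ≤ t := le_max_right _ _
  have hlt : 2 * (a + 2) ^ c * t ^ c < 2 ^ t := hT t (le_max_left _ _)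
  refine h.not_realZeroBound_of_lt_two_pow hmono (k := t - 1) ?_
  have hk : t - 1 + 1 = t := by omega
  show (a * (t - 1 + 1) + 2) ^ c < 2 ^ (t - 1)
  rw [hk]
  have h1 : (a * t + 2) ^ c ≤ (a + 2) ^ c * t ^ c := by
    rw [← mul_pow]
    exact Nat.pow_le_pow_left (by nlinarith) c
  have h2 : 2 ^ t = 2 * 2 ^ (t - 1) := by
    rw [← pow_succ']
    congr 1
    omega
  rw [h2] at hlt
  have h3 : (a + 2) ^ c * t ^ c < 2 ^ (t - 1) := by
    have := hlt
    rw [mul_assoc] at this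
    omega
  exact h1.trans_lt h3

/-! ### `τ` is squaring-cheap with constant `3` -/

/-- The tree's `τ` on `ℤ[X]` (the rendering of `RealZeroTauBound` / `CplxAlg.ShubSmaleTauConjecture`):
the constant-free fan-in-two complexity of the image of `f` in `MvPolynomial (Fin 1) ℤ`.
[cite: Koiran2011, §1 (p. 3)] -/
def tauMeasure (f : Polynomial ℤ) : ℕ :=
  constantFreeComplexity ((MvPolynomial.uniqueAlgEquiv ℤ (Fin 1)).symm f)

/-- `tauMeasure f` unfolds to `τ` of the image of `f`. [folklore] -/
theorem tauMeasure_apply (f : Polynomial ℤ) :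
    tauMeasure f = constantFreeComplexity ((MvPolynomial.uniqueAlgEquiv ℤ (Fin 1)).symm f) := rfl

/-- `τ(2g² - 1) ≤ τ(g) + 3` in `MvPolynomial σ ℤ`: square, double, subtract one (the three gates of
one Chebyshev step, `chebyshevCircuit`). [cite: Koiran2011, §1 (p. 3)] -/
theorem constantFreeComplexity_chebyshevStep_le {σ : Type} (g : MvPolynomial σ ℤ) :
    constantFreeComplexity (2 * g ^ 2 - 1) ≤ constantFreeComplexity g + 3 := by
  obtain ⟨P, hP1, hP2, hP3, hP4⟩ := exists_computes_size_eq_constantFreeComplexity g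
  have hsize : (subOne (double P.square)).size = P.size + 3 := by
    rw [size_subOne, size_double, size_square]
  rw [← hP4, ← hsize]
  refine constantFreeComplexity_le_size (isFanInTwo_subOne (isFanInTwo_double hP1.square))
    (hasSignConstants_subOne (hasSignConstants_double hP2.square)) ?_
  rw [Computes] at hP3 ⊢
  rw [eval_subOne, eval_double, square_eval, hP3]
  ring

/-- **`τ` is squaring-cheap with constant `3`**: `τ(X) = 0` and `τ(2p² - 1) ≤ τ(p) + 3`.
[cite: Koiran2011, §1 (p. 3)] -/
theorem isSquaringCheap_tau : IsSquaringCheap tauMeasure 3 := by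
  refine ⟨?_, fun p => ?_⟩
  · rw [tauMeasure_apply]
    have hX : (MvPolynomial.uniqueAlgEquiv ℤ (Fin 1)).symm (Polynomial.X : Polynomial ℤ) =
        MvPolynomial.X 0 := by
      rw [← T_one ℤ]
      exact_mod_cast chebyshevT_zero
    rw [hX, constantFreeComplexity_X]
    exact Nat.zero_le _
  · simp only [tauMeasure_apply, map_sub, map_mul, map_pow, map_one, map_ofNat]
    exact constantFreeComplexity_chebyshevStep_le _

/-! ### The barrier -/

/-- **Barrier (typed form of `TauRealZeros`, PROVED below): real-zero counting fails for every
squaring-cheap measure.** For every `μ : ℤ[X] → ℕ` and `a` with `μ X ≤ a` and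
`μ(2p² - 1) ≤ μ p + a` for all `p`, and every monotone `F : ℕ → ℕ` bounding the number of distinct
real zeros of all nonzero `f ∈ ℤ[X]` by `F(μ f)`: `2^k ≤ F(a(k + 1))` for every `k` — any such
bound grows at least exponentially; `μ = τ` (`a = 3`) is the printed case.

BARRIER
technique_class: real-root counting against ANY squaring-cheap size measure — formally pairs `(μ, a)` with `IsSquaringCheap μ a` (`μ X ≤ a`, `μ(2p² − 1) ≤ μ p + a`) and conclusions of the form "every nonzero `f ∈ ℤ[X]` has at most `F(μ f)` distinct real zeros" with `F` subexponential; this contains `RealZeroTauBound c` of `TauRealZeros.lean` (`μ = τ`, `isSquaringCheap_tau`, `F t = (t+2)^c`) and every other measure closed under the Chebyshev step at additive cost (e.g. `τ` with free constants, formula or circuit size in any gate basis containing `×` and affine maps with coefficients `±1, ±2`) [cite: Koiran2011, §1 (p. 3)].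
blocks: the real-analysis way to the Shub–Smale τ-statement on integer zeros (the tree statement in `Literature/Computability/AlgebraicComplexity/`, implied by any `RealZeroTauBound c` — `TauRealZeros.lean`) and thereby to the constant-free form of `ValiantsHypothesis` (route `ValiantsHypothesis/TauConst`), now for every squaring-cheap re-typing of `τ`: `IsSquaringCheap.two_pow_le_of_realZeroBound` (`2^k ≤ F(a(k+1))`), `IsSquaringCheap.not_realZeroBound_pow` (no shape `(μ f + 2)^c`), barrier `TauRealZerosSquaringTyped` proved (`tauRealZerosSquaringTyped_holds`) — Koiran: "this approach cannot work … because the number of real roots of a univariate polynomial can grow exponentially as a function of its arithmetic circuit size: Chebyshev polynomials provide such an example" [cite: Koiran2011, §1 (p. 3)]; Bürgisser: "false when replacing "integer zeros" by "real zeros"" [cite: Burgisser2024Completeness, §4.6] (full sentences in the module docstring).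
because: `T_{2^{k+1}} = 2T_{2^k}² − 1` (`T_two_pow_succ`), so `μ(T_{2^k}) ≤ μ(X) + k a ≤ a(k+1)` by `k` applications of the closure property (`IsSquaringCheap.apply_T_two_pow_le`), while `T_{2^k}` has `2^k` distinct real zeros `cos((2j+1)π/2^{k+1})` (`card_realRoots_chebyshevT`); a monotone bound then gives `2^k ≤ F(μ(T_{2^k})) ≤ F(a(k+1))` [cite: Koiran2011, §1 (p. 3)].
evasions_known: leave the technique class on either coordinate — (i) measures that are NOT squaring-cheap: formats in which the Chebyshev step is expensive, e.g. sums of `k` products of `m` `t`-sparse polynomials (Koiran's real-τ statement for that format, which still yields `per ∉ VP⁰`; tree decl in `TauRealZeros.lean`'s `evasions_known`) [cite: Koiran2011, §1 (p. 3) and §6 (Conj. 3)], the SoS-τ and complex-zero variants [cite: Burgisser2024Completeness, §4.6 (Conj. 4.1–4.2)]; (ii) count something other than real zeros: integer / `p`-adic / adelic counts (see the `evasions_known` of `TauRealZeros`) [cite: Burgisser2024Completeness, §4.6].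
scope_caveats: (a) only the two closure properties `μ X ≤ a`, `μ(2p² − 1) ≤ μ p + a` are used, and ONLY measures having them are covered — in particular nothing is said about size formats that are not closed under squaring, such as the lacunary-pencil format `(m, K)` of route `ValiantsHypothesis/LacunarySymmetroid` (crux `MatrixDescartes`; by that route's support statement `TwoTermSector` the Chebyshev tower is expensive there), about which this entry makes no claim; (b) real-zero COUNTS only (no statement about integer zeros — the integer-zero statement itself is open — nor about spacing-aware counts, for which see `not_separatedRealZeroTauBound` in `TauRealZeros.lean`, proved there for `μ = τ` only); (c) the constant `a(k+1)` (rather than `a k`) absorbs `μ X ≤ a`; for `μ = τ` the sharper `3k` is `constantFreeComplexity_chebyshevT_le`; (d) the sources state the obstruction for `τ` and qualitatively ("can grow exponentially"); the abstraction to arbitrary squaring-cheap `μ` is this file's bookkeeping of which properties of `τ` the printed argument uses.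
status: theorem (established for `μ = τ` [cite: Koiran2011, §1 (p. 3)] [cite: Burgisser2024Completeness, §4.6]; typed form proved here as `tauRealZerosSquaringTyped_holds`) -/
def TauRealZerosSquaringTyped : Prop :=
  ∀ (μ : Polynomial ℤ → ℕ) (a : ℕ), IsSquaringCheap μ a →
    ∀ F : ℕ → ℕ, Monotone F →
      (∀ f : Polynomial ℤ, f ≠ 0 → (f.map (Int.castRingHom ℝ)).roots.toFinset.card ≤ F (μ f)) →
        ∀ k : ℕ, 2 ^ k ≤ F (a * (k + 1))

/-- **The typed barrier holds.** [cite: Koiran2011, §1 (p. 3)] -/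
theorem tauRealZerosSquaringTyped_holds : TauRealZerosSquaringTyped :=
  fun _ _ h _ hF hb k => h.two_pow_le_of_realZeroBound hF hb k

/-- **The printed case as an instance**: for `μ = τ` (`a = 3`) the typed wall gives, for every
monotone real-zero bound `F` in terms of `τ`, `2^k ≤ F(3(k + 1))` (compare
`two_pow_le_of_realZeroBound` of `TauRealZeros.lean`, with the sharper `3k`; `TauRealZeros` itself
is `tauRealZeros_holds` there and is not restated). [cite: Koiran2011, §1 (p. 3)] -/
theorem two_pow_le_of_realZeroBound_tauMeasure {F : ℕ → ℕ} (hF : Monotone F)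
    (hb : ∀ f : Polynomial ℤ, f ≠ 0 →
      (f.map (Int.castRingHom ℝ)).roots.toFinset.card ≤ F (tauMeasure f)) (k : ℕ) :
    2 ^ k ≤ F (3 * (k + 1)) :=
  isSquaringCheap_tau.two_pow_le_of_realZeroBound hF hb k

/-! ### Addenda: measures given on `MvPolynomial (Fin 1) ℤ`, dominated measures, the
quasi-polynomial shape

Three proved complements recording the remaining clauses of the definition request
("for every measure `μ : ℤ[X] → ℕ` (or on `MvPolynomial (Fin 1) ℤ` as `constantFreeComplexity`) …
no bound `F(μ f)` on distinct real zeros with `F` subexponential"): the transport of the closure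
properties along `MvPolynomial.uniqueAlgEquiv ℤ (Fin 1)`, the inheritance of the wall by every
measure dominated pointwise by a squaring-cheap one (free constants only help: `L ≤ τ`), and the
quasi-polynomial shape, which for sums of products of sparse polynomials "would still be strong
enough to conclude that the permanent is not in VP⁰" [Koiran2011, §6 (p. 11)]. -/

/-- **Transport from `MvPolynomial (Fin 1) ℤ`.** If a measure `ν` on `MvPolynomial (Fin 1) ℤ` (such
as `CplxAlg.constantFreeComplexity` itself) satisfies `ν (X 0) ≤ a` and `ν (2q² - 1) ≤ ν q + a` for
all `q`, then the induced measure `f ↦ ν (f)` on `ℤ[X]` (image under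
`(MvPolynomial.uniqueAlgEquiv ℤ (Fin 1)).symm`, the rendering used by `RealZeroTauBound` and
`tauMeasure`) is squaring-cheap with constant `a`. [folklore] -/
theorem IsSquaringCheap.of_mvPolynomial {ν : MvPolynomial (Fin 1) ℤ → ℕ} {a : ℕ}
    (hX : ν (MvPolynomial.X 0) ≤ a)
    (hstep : ∀ q : MvPolynomial (Fin 1) ℤ, ν (2 * q ^ 2 - 1) ≤ ν q + a) :
    IsSquaringCheap (fun f => ν ((MvPolynomial.uniqueAlgEquiv ℤ (Fin 1)).symm f)) a := by
  refine ⟨?_, fun p => ?_⟩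
  · show ν ((MvPolynomial.uniqueAlgEquiv ℤ (Fin 1)).symm Polynomial.X) ≤ a
    have h : (MvPolynomial.uniqueAlgEquiv ℤ (Fin 1)).symm (Polynomial.X : Polynomial ℤ) =
        MvPolynomial.X 0 := by
      rw [← T_one ℤ]
      exact_mod_cast chebyshevT_zero
    rw [h]
    exact hX
  · show ν ((MvPolynomial.uniqueAlgEquiv ℤ (Fin 1)).symm (2 * p ^ 2 - 1)) ≤
        ν ((MvPolynomial.uniqueAlgEquiv ℤ (Fin 1)).symm p) + a
    simp only [map_sub, map_mul, map_pow, map_one, map_ofNat]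
    exact hstep _

/-- `isSquaringCheap_tau` re-derived through the transport (sanity check of
`IsSquaringCheap.of_mvPolynomial`: `τ(X 0) = 0`, `τ(2q² - 1) ≤ τ(q) + 3`). [folklore] -/
theorem isSquaringCheap_tau_of_mvPolynomial : IsSquaringCheap tauMeasure 3 :=
  IsSquaringCheap.of_mvPolynomial (ν := fun q => constantFreeComplexity q)
    (by simp) constantFreeComplexity_chebyshevStep_le

/-- **The wall is inherited by dominated measures.** If `μ' ≤ μ` pointwise and `μ` is
squaring-cheap with constant `a`, then every monotone bound `z_ℝ(f) ≤ F(μ' f)` on the distinct real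
zeros of all nonzero `f ∈ ℤ[X]` again forces `2^k ≤ F(a(k + 1))` for every `k` (`μ'` itself need not
be squaring-cheap). [folklore] -/
theorem IsSquaringCheap.two_pow_le_of_realZeroBound_of_le {μ μ' : Polynomial ℤ → ℕ} {a : ℕ}
    (h : IsSquaringCheap μ a) (hle : ∀ f, μ' f ≤ μ f) {F : ℕ → ℕ} (hF : Monotone F)
    (hb : ∀ f : Polynomial ℤ, f ≠ 0 → (f.map (Int.castRingHom ℝ)).roots.toFinset.card ≤ F (μ' f))
    (k : ℕ) : 2 ^ k ≤ F (a * (k + 1)) :=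
  h.two_pow_le_of_realZeroBound hF (fun f hf => (hb f hf).trans (hF (hle f))) k

/-- **Free constants do not help (instance `μ' = L`, Bürgisser's total complexity).** The
fan-in-two complexity `CplxAlg.complexity` over `ℤ` with ARBITRARY integer constants satisfies
`L(f) ≤ τ(f)` (`complexity_le_constantFreeComplexity_holds`; every integer polynomial has a
constant-free circuit, `exists_computes_hasSignConstants_holds`), so every monotone real-zero bound
`z_ℝ(f) ≤ F(L f)` forces `2^k ≤ F(3(k + 1))` ("the number of real roots of a univariate polynomial
can grow exponentially as a function of its arithmetic circuit size"). [cite: Koiran2011, §1 (p. 3)] -/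
theorem two_pow_le_of_realZeroBound_complexity {F : ℕ → ℕ} (hF : Monotone F)
    (hb : ∀ f : Polynomial ℤ, f ≠ 0 →
      (f.map (Int.castRingHom ℝ)).roots.toFinset.card ≤
        F (complexity ((MvPolynomial.uniqueAlgEquiv ℤ (Fin 1)).symm f))) (k : ℕ) :
    2 ^ k ≤ F (3 * (k + 1)) :=
  isSquaringCheap_tau.two_pow_le_of_realZeroBound_of_le
    (μ' := fun f => complexity ((MvPolynomial.uniqueAlgEquiv ℤ (Fin 1)).symm f))
    (fun _ => complexity_le_constantFreeComplexity_holds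
      (ArithCircuit.exists_computes_hasSignConstants_holds _)) hF hb k

/-- **The quasi-polynomial shape is excluded for every squaring-cheap measure**: for no `c` is
`2^{(log₂ (μ f + 2))^c}` a bound on the distinct real zeros of every nonzero `f ∈ ℤ[X]` when `μ` is
squaring-cheap with some constant `a` — the typed form of `not_realZeroBound_quasipoly` of
`TauRealZeros.lean` (`μ = τ`). Relevant because for sums of products of sparse polynomials already
a bound `q(s) ≤ 2^{(log s)^{1+c}}` "would still be strong enough to conclude that the permanent is
not in VP⁰". Witness `T_{2^k}` with `k + 1 = 2^m`: `(log₂(a 2^m + 2))^c ≤ ((a+3)m)^c < 2^{m-1}`.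
[cite: Koiran2011, §6 (p. 11)] -/
theorem IsSquaringCheap.not_realZeroBound_quasipoly {μ : Polynomial ℤ → ℕ} {a : ℕ}
    (h : IsSquaringCheap μ a) (c : ℕ) :
    ¬ ∀ f : Polynomial ℤ, f ≠ 0 →
      (f.map (Int.castRingHom ℝ)).roots.toFinset.card ≤ 2 ^ Nat.log 2 (μ f + 2) ^ c := by
  have hmono : Monotone fun t : ℕ => 2 ^ Nat.log 2 (t + 2) ^ c := fun s t hst =>
    Nat.pow_le_pow_right two_pos (Nat.pow_le_pow_left (Nat.log_mono_right (by omega)) c)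
  obtain ⟨T₀, hT⟩ := eventually_mul_pow_lt_two_pow c (2 * (a + 3) ^ c)
  set m : ℕ := max T₀ 1 with hm
  have hm1 : 1 ≤ m := le_max_right _ _
  have hlt : 2 * (a + 3) ^ c * m ^ c < 2 ^ m := hT m (le_max_left _ _)
  refine h.not_realZeroBound_of_lt_two_pow hmono (k := 2 ^ m - 1) ?_
  have h2m : 1 ≤ 2 ^ m := Nat.one_le_two_pow
  have hk : 2 ^ m - 1 + 1 = 2 ^ m := by omega
  show 2 ^ Nat.log 2 (a * (2 ^ m - 1 + 1) + 2) ^ c < 2 ^ (2 ^ m - 1)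
  rw [hk]
  apply Nat.pow_lt_pow_right (by norm_num)
  -- the exponent: `(log₂ (a 2^m + 2))^c ≤ ((a + 3) m)^c < 2^(m-1) ≤ 2^m - 1`
  have hlog : Nat.log 2 (a * 2 ^ m + 2) < m + (a + 2) := by
    apply Nat.log_lt_of_lt_pow (by omega)
    have h2a : a + 3 ≤ 2 ^ (a + 2) := by
      have := (Nat.lt_two_pow_self : a + 2 < 2 ^ (a + 2))
      omega
    calc a * 2 ^ m + 2 < (a + 3) * 2 ^ m := by nlinarith
      _ ≤ 2 ^ (a + 2) * 2 ^ m := Nat.mul_le_mul_right _ h2a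
      _ = 2 ^ (m + (a + 2)) := by ring
  have hle : Nat.log 2 (a * 2 ^ m + 2) ≤ (a + 3) * m := by nlinarith
  have h1 : Nat.log 2 (a * 2 ^ m + 2) ^ c ≤ (a + 3) ^ c * m ^ c := by
    rw [← mul_pow]
    exact Nat.pow_le_pow_left hle c
  have h3 : 2 ^ m = 2 * 2 ^ (m - 1) := by
    rw [← pow_succ']
    congr 1
    omega
  have h6 : 1 ≤ 2 ^ (m - 1) := Nat.one_le_two_pow
  have h5 : (a + 3) ^ c * m ^ c < 2 ^ (m - 1) := by
    rw [h3, mul_assoc] at hlt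
    omega
  have h4 : 2 ^ (m - 1) ≤ 2 ^ m - 1 := by
    rw [h3]
    omega
  calc Nat.log 2 (a * 2 ^ m + 2) ^ c ≤ (a + 3) ^ c * m ^ c := h1
    _ < 2 ^ (m - 1) := h5
    _ ≤ 2 ^ m - 1 := h4

/-- The quasi-polynomial shape for the dominated measure `L` (free integer constants): for no `c`
is `2^{(log₂ (L f + 2))^c}` a real-zero bound. [cite: Koiran2011, §6 (p. 11)] -/
theorem not_realZeroBound_quasipoly_complexity (c : ℕ) :
    ¬ ∀ f : Polynomial ℤ, f ≠ 0 →
      (f.map (Int.castRingHom ℝ)).roots.toFinset.card ≤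
        2 ^ Nat.log 2 (complexity ((MvPolynomial.uniqueAlgEquiv ℤ (Fin 1)).symm f) + 2) ^ c := by
  intro hb
  refine isSquaringCheap_tau.not_realZeroBound_quasipoly c (fun f hf => (hb f hf).trans ?_)
  have hle : complexity ((MvPolynomial.uniqueAlgEquiv ℤ (Fin 1)).symm f) ≤ tauMeasure f :=
    complexity_le_constantFreeComplexity_holds
      (ArithCircuit.exists_computes_hasSignConstants_holds _)
  exact Nat.pow_le_pow_right two_pos (Nat.pow_le_pow_left (Nat.log_mono_right (by omega)) c)

end Literature.Barriers.ValiantsHypothesis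

end
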